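import Summits.QuantumFields.YangMills.Theorems.HypercubicLimit.Negative.TelescopingGuards

/-!
# `HypercubicLimit` — line `conditional-mean-telescoping`: the `R = 0` instance of (WI₂) is an identity

Support file for crux `stmt-QuantumFields-8646` (`HypercubicLimit`), refuter side (drefute gen 4), about the radius
guard `1 ≤ R →` of the window stub (WI₂) `CornerFreeInfluence` (first conjunct of the registered `stub_influenceWindow`):
at the excluded radius `R = 0` the cube `Q_0(x)` has no interior edge (`cubeEdges_zero`), the exterior σ-algebra is
everything (`exterior_zero`), the influence profile is the plain `Lᵖ` norm of the centred plaquette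
(`influence_radius_zero` — the landed-mirror form of cdisprove's §10 lemma, now with the base site of reshape 2), and the
reference RP square at height `0` is the VARIANCE of `p₀₁(0)` (`rpSquare_zero`: the height-0 temporal plaquette is
`Θ`-invariant, `torusPlaquette_timeReflect_temporal` at `x = 0`).  Hence at the anchor site/orientation the (WI₂)
inequality at `R = 0` is the IDENTITY `influence r β S 0 0 0 1 2 = √(rpSquare r β S 0)` (`influence_radius_zero_eq_sqrt_rpSquare`)
and its body holds there for every `C ≥ 1` (`cornerFree_body_radius_zero`): the guard `1 ≤ R` of (WI₂) excludes no false
instance at the anchor (information for the prover; for other sites/orientations the same follows from the lattice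
symmetries of the torus Wilson state, not formalised here).  Objects are the tree mirrors of `TelescopingGuards.lean` /
`ReflectedDensity.lean` (verbatim copies of the line's).
-/

noncomputable section

open scoped ENNReal
open MeasureTheory Filter Topology ProbabilityTheory
open Literature.MathematicalPhysics.AQFT Literature.MathematicalPhysics.QuantumLattice
open Literature.MathematicalPhysics.QuantumFieldTheory

namespace Summit.QuantumFields.YangMills.Theorems.HypercubicLimit.Negative

variable {G : Type} [Group G] [TopologicalSpace G] [IsTopologicalGroup G] [CompactSpace G]
  [MeasurableSpace G] [BorelSpace G]

omit [Group G] [TopologicalSpace G] [IsTopologicalGroup G] [CompactSpace G] [MeasurableSpace G] [BorelSpace G] in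
/-- The radius-`0` cube has no interior edge. [folklore] -/
theorem cubeEdges_zero (x : Fin 4 → ℤ) : cubeEdges 0 x = ∅ := by
  ext e
  simp only [cubeEdges, Nat.cast_zero, Set.mem_setOf_eq, Set.mem_empty_iff_false, iff_false, not_and,
    not_forall]
  intro h1
  refine ⟨e.2, ?_⟩
  have := h1 e.2
  rw [abs_nonpos_iff, sub_eq_zero] at this
  simp [this]

omit [Group G] [TopologicalSpace G] [IsTopologicalGroup G] [CompactSpace G] [BorelSpace G] in
/-- At radius `0` the exterior σ-algebra is the whole product σ-algebra. [folklore] -/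
theorem exterior_zero (L : ℕ) (x : Fin 4 → ℤ) : exterior (G := G) L 0 x = MeasurableSpace.pi := by
  simp [exterior, cubeEdgesT, cubeEdges_zero]

/-- **At radius `0` the influence profile is the plain `Lᵖ` norm of the centred plaquette** (conditioning on
everything). [folklore] -/
theorem influence_radius_zero (r : LatticeRep G) (β : ℝ) (S : ℕ) (x : Fin 4 → ℤ) (i j : Fin 4) (p : ℝ≥0∞) :
    influence r β S 0 x i j p =
      (eLpNorm (fun U => torusPlaquette r (2 * S + 1) i j x U -
          ∫ V, torusPlaquette r (2 * S + 1) i j x V ∂(wilsonMeasure (d := 4) (L := 2 * S + 1) r.ρ β))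
        p (wilsonMeasure (d := 4) (L := 2 * S + 1) r.ρ β)).toReal := by
  haveI := isProbabilityMeasure_wilsonMeasure (d := 4) (L := 2 * S + 1) r.ρ r.continuous β
  simp only [influence]
  rw [exterior_zero]
  congr 2
  refine condExp_of_stronglyMeasurable (m := MeasurableSpace.pi) (μ := wilsonMeasure r.ρ β) le_rfl ?_ ?_
  · exact ((measurable_torusPlaquette r _ i j x).sub measurable_const).stronglyMeasurable
  · refine Integrable.of_bound
      ((measurable_torusPlaquette r _ i j x).sub measurable_const).aestronglyMeasurable (2 * r.N)
      (Eventually.of_forall fun U => ?_)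
    rw [Real.norm_eq_abs]
    exact abs_centred_torusPlaquette_le r _ i j x _ U

omit [MeasurableSpace G] [BorelSpace G] in
/-- The height-`0` temporal plaquette `p₀₁(0)` is invariant under the torus time reflection `Θ` (it hangs down
from `θ0 = e₀` onto itself). [folklore] -/
theorem torusPlaquette_timeReflect_height_zero (r : LatticeRep G) (L : ℕ) (U : GaugeConfig 4 L G) :
    torusPlaquette r L 0 1 0 U.timeReflect = torusPlaquette r L 0 1 0 U := by
  rw [torusPlaquette_timeReflect_temporal r L zero_lt_one 0 U]
  congr 1
  ext k
  by_cases hk : k = 0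
  · subst hk; simp [thetaZ]
  · simp [thetaZ, hk]

/-- **The reference RP square at height `0` is the variance of `p₀₁(0)`.** [folklore] -/
theorem rpSquare_zero (r : LatticeRep G) (β : ℝ) (S : ℕ) :
    rpSquare r β S 0 =
      ∫ U, (torusPlaquette r (2 * S + 1) 0 1 0 U -
          ∫ V, torusPlaquette r (2 * S + 1) 0 1 0 V ∂(wilsonMeasure (d := 4) (L := 2 * S + 1) r.ρ β)) ^ 2
        ∂(wilsonMeasure (d := 4) (L := 2 * S + 1) r.ρ β) := by
  have h0 : (Pi.single 0 ((0 : ℕ) : ℤ) : Fin 4 → ℤ) = 0 := by simp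
  simp only [rpSquare, h0, torusPlaquette_timeReflect_height_zero, sq]

/-- **At `R = 0` the (WI₂) inequality is an identity at the anchor**: `influence(β,S,0; 0,(0,1); L²) = √rpSquare(β,S,0)`.
[folklore] -/
theorem influence_radius_zero_eq_sqrt_rpSquare (r : LatticeRep G) (β : ℝ) (S : ℕ) :
    influence r β S 0 0 0 1 2 = Real.sqrt (rpSquare r β S 0) := by
  haveI := isProbabilityMeasure_wilsonMeasure (d := 4) (L := 2 * S + 1) r.ρ r.continuous β
  set μ := wilsonMeasure (d := 4) (L := 2 * S + 1) r.ρ β with hμ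
  set X : GaugeConfig 4 (2 * S + 1) G → ℝ := fun U =>
    torusPlaquette r (2 * S + 1) 0 1 0 U - ∫ V, torusPlaquette r (2 * S + 1) 0 1 0 V ∂μ with hX
  have hXm : AEStronglyMeasurable X μ :=
    ((measurable_torusPlaquette r _ 0 1 0).sub measurable_const).aestronglyMeasurable
  have hXb : ∀ᵐ U ∂μ, ‖X U‖ ≤ 2 * r.N := Eventually.of_forall fun U => by
    rw [Real.norm_eq_abs]
    exact abs_centred_torusPlaquette_le r _ 0 1 0 _ U
  have hmem : MemLp X 2 μ := MemLp.of_bound hXm _ hXb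
  rw [influence_radius_zero, rpSquare_zero]
  change (eLpNorm X 2 μ).toReal = Real.sqrt (∫ U, X U ^ 2 ∂μ)
  rw [hmem.eLpNorm_eq_integral_rpow_norm two_ne_zero ENNReal.ofNat_ne_top]
  have h2 : (2 : ℝ≥0∞).toReal = 2 := by norm_num
  rw [h2]
  have hint : ∫ U, ‖X U‖ ^ (2 : ℝ) ∂μ = ∫ U, X U ^ 2 ∂μ := by
    refine integral_congr_ae (Eventually.of_forall fun U => ?_)
    simp only [Real.rpow_two, Real.norm_eq_abs, sq_abs]
  rw [hint, ENNReal.toReal_ofReal (by positivity), Real.sqrt_eq_rpow, one_div]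

/-- **The body of (WI₂) at `R = 0` holds at the anchor for every constant `C ≥ 1`.** [folklore] -/
theorem cornerFree_body_radius_zero (r : LatticeRep G) (β : ℝ) (S : ℕ) {C : ℝ} (hC : 1 ≤ C) :
    influence r β S 0 0 0 1 2 ≤ C * Real.sqrt (rpSquare r β S 0) := by
  rw [influence_radius_zero_eq_sqrt_rpSquare]
  exact le_mul_of_one_le_left (Real.sqrt_nonneg _) hC

end Summit.QuantumFields.YangMills.Theorems.HypercubicLimit.Negative

end
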